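import Summits.ValiantsHypothesis.ValiantsHypothesis.Theorems.MonotoneRestorationOrbitRestorationQPTermBlocksPairedVandermondes
import HarnessLib

/-!
# Products of two power sums of the column Vandermondes of even total degree restore uniformly
# (the generators of the even subalgebra `ℂ[D_1,…,D_n]^{even, Sym}`; term-block criterion with multiplicities)

Route MonotoneRestoration, crux `OrbitRestorationQP` (stmt-ValiantsHypothesis-18293), line `depth-three-rung`, rung
`A_∞ = stub_sigmaPiSigmaValue`; namespace `Summit.ValiantsHypothesis.ValiantsHypothesis.Theorems.TermBlocks`.

With `D_j = Π_{i<i'} (x_{ij} − x_{i'j})` the column Vandermondes and `p_a(D) = Σ_j D_j^a`: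

* `qpOrbitRestorable_psum_mul_psum_columnVandermondes` — **for `a + b` even, `p_a(D) · p_b(D)` is
  `QPOrbitRestorable 9 n` for every `n`**: the term system over ORDERED pairs of columns `(j, j')` with blocks
  `{±(x_{ij} − x_{i'j})}^{a} ∪ {±(x_{ij'} − x_{i'j'})}^{b}` (one per row pair `{i,i'}`, oriented by its minimum), whose
  products pick up `sgn^{a+b} = 1` — an instance of `qpOrbitRestorable_of_termBlocks` with multiplicities.  For `a`, `b`
  odd neither factor `p_a(D)`, `p_b(D)` is a value of any small-orbit computation (they are reversed by the row
  transpositions, cf. `ValueSymSupport.exists_symSupport`); `b = 0` gives the even power sums `n · p_{2k}(D)`-free form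
  `p_{2k}(D) · p_0(D) = n · p_{2k}(D)`.
* `isMatrixSymmetric_psum_mul_psum_columnVandermondes` — the family is matrix-symmetric when `a + b` is even.

Why this matters (census, `TERM-BLOCKS-g7g3.md` on the crux item): the even symmetric polynomials in `D_1, …, D_n` —
e.g. `e_{2m}(D)` with `m` growing, a matrix-symmetric VP family with `C(n,2m)` depth-three terms — are polynomials in
the invariant values `p_{2k}(D)` and `p_a(D) p_b(D)` (`a, b` odd), all landed here with ONE constant; a single value
derivation through them (Newton's identities run inside the even subalgebra) restores the whole even subalgebra.  That
assembly is not done here.  The stub, the crux and VP ≠ VNP are not moved.  Everything is proved. [folklore]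

## References
* A. Dawar, G. Wilsenach, *Symmetric arithmetic circuits*, ToC 21 (2025), §3.3, Def. 6.1. [DawarWilsenach2025]
-/

noncomputable section

open scoped Classical Pointwise

-- `Summit.ValiantsHypothesis.ValiantsHypothesis.…` is the tree's single-conjunct layout (Sub = Summit).
set_option linter.dupNamespace false

namespace Summit.ValiantsHypothesis.ValiantsHypothesis.Theorems

namespace TermBlocks

open MvPolynomial Equiv Finset Literature.Computability.AlgebraicComplexity OrbitRestorationQPDepthThreeRung

variable {n : ℕ}

/-- **`p_a(D) · p_b(D)` IS ORBIT-RESTORABLE FOR `a + b` EVEN, UNIFORMLY** (`D_j` the column Vandermondes).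
[folklore; cite: DawarWilsenach2025, §3.3 and Def. 6.1] -/
theorem qpOrbitRestorable_psum_mul_psum_columnVandermondes (a b n : ℕ) (hab : Even (a + b)) :
    QPOrbitRestorable 9 n
      ((∑ j : Fin n, (∏ i : Fin n, ∏ i' ∈ Ioi i, (X (i, j) - X (i', j) : MvPolynomial (Fin n × Fin n) ℂ)) ^ a) *
        ∑ j : Fin n, (∏ i : Fin n, ∏ i' ∈ Ioi i, (X (i, j) - X (i', j) : MvPolynomial (Fin n × Fin n) ℂ)) ^ b) := by
  -- the data of the term-block system: terms = ordered pairs of columns, blocks = (row pair, term)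
  set ε : Finset (Fin n) → Fin n → ℂ := fun A x => if ∀ a' ∈ A, x ≤ a' then (1 : ℂ) else -1 with hε
  set d : Finset (Fin n) → Fin n → MvPolynomial (Fin n × Fin n) ℂ :=
    fun A j => ∑ x ∈ A, C (ε A x) * X (x, j) with hd
  set M : Finset (Fin n) × (Fin n × Fin n) → Multiset (MvPolynomial (Fin n × Fin n) ℂ) :=
    fun bb => if bb.1.card = 2 then
      Multiset.replicate a (d bb.1 bb.2.1) + Multiset.replicate b (d bb.1 bb.2.2) else 0 with hM
  set cf : Fin n × Fin n → ℂ := fun _ => 1 with hcf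
  -- the sign rule for the oriented differences
  have hsgn : ∀ (σ : Perm (Fin n)) (A : Finset (Fin n)), A.card = 2 → ∃ s : ℂ, s * s = 1 ∧
      ∀ j : Fin n, ren σ (d A j) = C s * d (σ • A) (σ j) := by
    intro σ A hA
    obtain ⟨a₁, a₂, h12, rfl⟩ := card_eq_two.1 hA
    have hσ12 : σ a₁ ≠ σ a₂ := fun h => h12 (σ.injective h)
    have hσA : σ • ({a₁, a₂} : Finset (Fin n)) = {σ a₁, σ a₂} := by
      rw [smul_finset_insert, smul_finset_singleton]; rfl
    refine ⟨(if a₁ < a₂ then (1 : ℂ) else -1) * (if σ a₁ < σ a₂ then (1 : ℂ) else -1), ?_, fun j => ?_⟩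
    · split_ifs <;> norm_num
    · have e1 : d {a₁, a₂} j = C (if a₁ < a₂ then (1 : ℂ) else -1) * (X (a₁, j) - X (a₂, j)) :=
        sum_pair_orient h12 j
      have e2 : d (σ • ({a₁, a₂} : Finset (Fin n))) (σ j) =
          C (if σ a₁ < σ a₂ then (1 : ℂ) else -1) * (X (σ a₁, σ j) - X (σ a₂, σ j)) := by
        rw [hσA]; exact sum_pair_orient hσ12 (σ j)
      rw [e1, e2, map_mul, ren_C, map_sub, ren_X, ren_X]
      have hp1 : σ • ((a₁, j) : Fin n × Fin n) = (σ a₁, σ j) := rfl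
      have hp2 : σ • ((a₂, j) : Fin n × Fin n) = (σ a₂, σ j) := rfl
      rw [hp1, hp2, ← mul_assoc, ← map_mul]
      congr 2
      split_ifs <;> norm_num
  have hfix : ∀ (σ : Perm (Fin n)) (A : Finset (Fin n)) (j : Fin n), (∀ x ∈ A, σ x = x) → σ j = j →
      ren σ (d A j) = d A j := by
    intro σ A j hA hj
    rw [hd]
    simp only [map_sum, map_mul, ren_C, ren_X]
    refine sum_congr rfl fun x hx => ?_
    have hp : σ • ((x, j) : Fin n × Fin n) = (σ x, σ j) := rfl
    rw [hp, hA x hx, hj]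
  have hdeg : ∀ (A : Finset (Fin n)) (j : Fin n), (d A j).totalDegree ≤ 1 := by
    intro A j
    rw [hd]
    refine totalDegree_finsetSum_le fun x _ => ?_
    calc (C (ε A x) * X (x, j)).totalDegree ≤ (C (ε A x)).totalDegree + (X (x, j)).totalDegree :=
          totalDegree_mul _ _
      _ ≤ 0 + 1 := Nat.add_le_add (by rw [totalDegree_C]) (totalDegree_X _).le
      _ = 1 := rfl
  -- even total multiplicity kills the sign
  have hpow : ∀ s : ℂ, s * s = 1 → s ^ (a + b) = 1 := by
    intro s hs
    obtain ⟨m, hm⟩ := hab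
    rw [hm, ← two_mul, pow_mul, sq, hs, one_pow]
  have main := TermBlocks.qpOrbitRestorable_of_termBlocks (n := n) (k := 4)
    (B := Finset (Fin n) × (Fin n × Fin n)) (T := Fin n × Fin n) Prod.snd (fun σ bb => rfl) M cf
    (fun σ t => rfl) ?_ ?_ ?_ ?_ ?_
  rotate_left
  · -- affine
    rintro ⟨A, ⟨j, j'⟩⟩ q hq
    simp only [hM] at hq
    split_ifs at hq with h
    · rcases Multiset.mem_add.1 hq with hq | hq
      · rw [Multiset.eq_of_mem_replicate hq]; exact hdeg A j
      · rw [Multiset.eq_of_mem_replicate hq]; exact hdeg A j'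
    · simp at hq
  · -- supported
    rintro ⟨A, ⟨j, j'⟩⟩ q hq
    simp only [hM] at hq
    split_ifs at hq with h
    · rcases Multiset.mem_add.1 hq with hq | hq
      · rw [Multiset.eq_of_mem_replicate hq]
        refine ⟨insert j A, (card_insert_le j A).trans (by omega), fun σ hσ =>
          hfix σ A j (fun x hx => hσ x (mem_insert_of_mem hx)) (hσ j (mem_insert_self j A))⟩
      · rw [Multiset.eq_of_mem_replicate hq]
        refine ⟨insert j' A, (card_insert_le j' A).trans (by omega), fun σ hσ =>
          hfix σ A j' (fun x hx => hσ x (mem_insert_of_mem hx)) (hσ j' (mem_insert_self j' A))⟩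
    · simp at hq
  · -- exactly permuted by the pointwise stabiliser of `A ∪ {j, j'}`
    rintro ⟨A, ⟨j, j'⟩⟩
    by_cases h : A.card = 2
    · refine ⟨insert j (insert j' A), ?_, fun σ hσ => ?_⟩
      · exact (card_insert_le _ _).trans ((Nat.add_le_add_right (card_insert_le _ _) 1).trans (by omega))
      · have hA : ∀ x ∈ A, σ x = x := fun x hx => hσ x (mem_insert_of_mem (mem_insert_of_mem hx))
        have hj : σ j = j := hσ j (mem_insert_self _ _)
        have hj' : σ j' = j' := hσ j' (mem_insert_of_mem (mem_insert_self _ _))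
        simp only [hM, if_pos h, Multiset.map_add, Multiset.map_replicate, hfix σ A j hA hj,
          hfix σ A j' hA hj']
    · refine ⟨∅, by simp, fun σ _ => ?_⟩
      simp only [hM, if_neg h, Multiset.map_zero]
  · -- block products honestly permuted: `sgn^{a+b} = 1`
    rintro σ ⟨A, ⟨j, j'⟩⟩
    have hcardA : (σ • A).card = A.card := card_smul_finset σ A
    show ren σ (M (A, (j, j'))).prod = (M (σ • A, (σ j, σ j'))).prod
    by_cases h : A.card = 2
    · have h' : (σ • A).card = 2 := by rw [hcardA]; exact h
      simp only [hM, if_pos h, if_pos h', Multiset.prod_add, Multiset.prod_replicate, map_mul, map_pow]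
      obtain ⟨s, hs, hsj⟩ := hsgn σ A h
      rw [hsj j, hsj j', mul_pow, mul_pow, ← map_pow, ← map_pow]
      calc C (s ^ a) * d (σ • A) (σ j) ^ a * (C (s ^ b) * d (σ • A) (σ j') ^ b)
          = C (s ^ (a + b)) * (d (σ • A) (σ j) ^ a * d (σ • A) (σ j') ^ b) := by rw [pow_add, map_mul]; ring
        _ = d (σ • A) (σ j) ^ a * d (σ • A) (σ j') ^ b := by rw [hpow s hs, map_one, one_mul]
    · have h' : ¬(σ • A).card = 2 := by rw [hcardA]; exact h
      simp only [hM, if_neg h, if_neg h', Multiset.prod_zero, map_one]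
  · -- terms fixed by the pointwise stabiliser of their two columns
    rintro ⟨j, j'⟩ -
    refine ⟨{j, j'}, card_le_two.trans (by omega), fun σ hσ => ?_⟩
    show (σ j, σ j') = (j, j')
    rw [hσ j (by simp), hσ j' (by simp)]
  -- rewriting the conclusion
  have hD : ∀ j : Fin n, ∏ A : Finset (Fin n), (if A.card = 2 then d A j else 1) =
      ∏ i : Fin n, ∏ i' ∈ Ioi i, (X (i, j) - X (i', j) : MvPolynomial (Fin n × Fin n) ℂ) := by
    intro j
    rw [← prod_filter, show (univ : Finset (Finset (Fin n))).filter (fun A => A.card = 2) =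
      (univ : Finset (Fin n)).powersetCard 2 by rw [powersetCard_eq_filter, powerset_univ], prod_powersetCard_two]
    refine prod_congr rfl fun i _ => prod_congr rfl fun i' hi' => ?_
    have hlt : i < i' := mem_Ioi.1 hi'
    rw [show d {i, i'} j = C (if i < i' then (1 : ℂ) else -1) * (X (i, j) - X (i', j)) from
      sum_pair_orient (ne_of_lt hlt) j, if_pos hlt, map_one, one_mul]
  have hterm : ∀ t : Fin n × Fin n,
      ∏ bb ∈ univ.filter (fun bb : Finset (Fin n) × (Fin n × Fin n) => bb.2 = t), (M bb).prod =
        (∏ i : Fin n, ∏ i' ∈ Ioi i, (X (i, t.1) - X (i', t.1) : MvPolynomial (Fin n × Fin n) ℂ)) ^ a *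
        (∏ i : Fin n, ∏ i' ∈ Ioi i, (X (i, t.2) - X (i', t.2) : MvPolynomial (Fin n × Fin n) ℂ)) ^ b := by
    rintro ⟨j, j'⟩
    rw [prod_filter, Fintype.prod_prod_type]
    simp only [prod_ite_eq', mem_univ, if_true]
    have hblock : ∀ A : Finset (Fin n), (M (A, (j, j'))).prod =
        (if A.card = 2 then d A j else 1) ^ a * (if A.card = 2 then d A j' else 1) ^ b := by
      intro A
      by_cases hA : A.card = 2
      · simp only [hM, if_pos hA, Multiset.prod_add, Multiset.prod_replicate]
      · simp only [hM, if_neg hA, Multiset.prod_zero, one_pow, mul_one]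
    simp only [hblock]
    rw [prod_mul_distrib, prod_pow, prod_pow, hD j, hD j']
  have hsum : (∑ t : Fin n × Fin n, C (cf t) *
        ∏ bb ∈ univ.filter (fun bb : Finset (Fin n) × (Fin n × Fin n) => bb.2 = t), (M bb).prod) =
      (∑ j : Fin n, (∏ i : Fin n, ∏ i' ∈ Ioi i, (X (i, j) - X (i', j) : MvPolynomial (Fin n × Fin n) ℂ)) ^ a) *
        ∑ j : Fin n, (∏ i : Fin n, ∏ i' ∈ Ioi i, (X (i, j) - X (i', j) : MvPolynomial (Fin n × Fin n) ℂ)) ^ b := by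
    simp only [hcf, map_one, one_mul, hterm]
    rw [Fintype.sum_prod_type, Finset.sum_mul_sum]
  rw [← hsum]
  convert main

/-- **`p_a(D) · p_b(D)` is matrix-symmetric for `a + b` even.** [folklore] -/
theorem isMatrixSymmetric_psum_mul_psum_columnVandermondes (a b : ℕ) (hab : Even (a + b)) :
    IsMatrixSymmetric fun n =>
      (∑ j : Fin n, (∏ i : Fin n, ∏ i' ∈ Ioi i, (X (i, j) - X (i', j) : MvPolynomial (Fin n × Fin n) ℂ)) ^ a) *
        ∑ j : Fin n, (∏ i : Fin n, ∏ i' ∈ Ioi i, (X (i, j) - X (i', j) : MvPolynomial (Fin n × Fin n) ℂ)) ^ b := by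
  intro n σ τ
  set s : MvPolynomial (Fin n × Fin n) ℂ := ((Equiv.Perm.sign σ : ℤ) : MvPolynomial (Fin n × Fin n) ℂ) with hsdef
  have hs : s * s = 1 := by
    rw [hsdef, ← Int.cast_mul, ← Units.val_mul, Int.units_mul_self, Units.val_one, Int.cast_one]
  have hsab : s ^ (a + b) = 1 := by
    obtain ⟨m, hm⟩ := hab
    rw [hm, ← two_mul, pow_mul, sq, hs, one_pow]
  have hcol : ∀ j : Fin n, ∏ i : Fin n, ∏ i' ∈ Ioi i,
      (rename (fun p : Fin n × Fin n => (σ p.1, τ p.2)) (X (i, j) - X (i', j)) : MvPolynomial (Fin n × Fin n) ℂ) =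
        s * ∏ i : Fin n, ∏ i' ∈ Ioi i, (X (i, τ j) - X (i', τ j)) := by
    intro j
    simp only [map_sub, rename_X]
    exact Equiv.Perm.prod_Ioi_comp_eq_sign_mul_prod σ
      (f := fun i i' => (X (i, τ j) - X (i', τ j) : MvPolynomial (Fin n × Fin n) ℂ)) fun i i' => (neg_sub _ _).symm
  simp only [map_mul, map_sum, map_pow, map_prod, hcol, mul_pow]
  rw [← Finset.mul_sum, ← Finset.mul_sum]
  have hA : ∑ j : Fin n, (∏ i : Fin n, ∏ i' ∈ Ioi i, (X (i, τ j) - X (i', τ j) : MvPolynomial (Fin n × Fin n) ℂ)) ^ a =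
      ∑ j : Fin n, (∏ i : Fin n, ∏ i' ∈ Ioi i, (X (i, j) - X (i', j) : MvPolynomial (Fin n × Fin n) ℂ)) ^ a :=
    Fintype.sum_equiv τ _ _ fun j => rfl
  have hB : ∑ j : Fin n, (∏ i : Fin n, ∏ i' ∈ Ioi i, (X (i, τ j) - X (i', τ j) : MvPolynomial (Fin n × Fin n) ℂ)) ^ b =
      ∑ j : Fin n, (∏ i : Fin n, ∏ i' ∈ Ioi i, (X (i, j) - X (i', j) : MvPolynomial (Fin n × Fin n) ℂ)) ^ b :=
    Fintype.sum_equiv τ _ _ fun j => rfl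
  rw [hA, hB]
  calc s ^ a * (∑ j : Fin n, (∏ i : Fin n, ∏ i' ∈ Ioi i, (X (i, j) - X (i', j) : MvPolynomial (Fin n × Fin n) ℂ)) ^ a) *
        (s ^ b * ∑ j : Fin n, (∏ i : Fin n, ∏ i' ∈ Ioi i, (X (i, j) - X (i', j) : MvPolynomial (Fin n × Fin n) ℂ)) ^ b)
      = s ^ (a + b) * ((∑ j : Fin n, (∏ i : Fin n, ∏ i' ∈ Ioi i,
          (X (i, j) - X (i', j) : MvPolynomial (Fin n × Fin n) ℂ)) ^ a) *
          ∑ j : Fin n, (∏ i : Fin n, ∏ i' ∈ Ioi i, (X (i, j) - X (i', j) : MvPolynomial (Fin n × Fin n) ℂ)) ^ b) := by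
        rw [pow_add]; ring
    _ = _ := by rw [hsab, one_mul]

end TermBlocks

end Summit.ValiantsHypothesis.ValiantsHypothesis.Theorems

end
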